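import Mathlib
import HarnessLib
import HarnessLib.Audit
import Summits.FinalStateConjecture.Statement
import Literature.Geometry.Lorentzian.TangentProfile
import Literature.Geometry.Lorentzian.IdealPoints
import Literature.Geometry.Lorentzian.TameGenericityLocal
import Summits.FinalStateConjecture.FinalStateConjecture.Theorems.CurvatureOrSymmetryLocalExitSuffices

/-!
Route: NoVacuumStrings

DORMANT since 2026-09-04T18:32:06Z (reconciler: no traction for 5 d (last activity statement-checked at 2026-08-30T17:35:43Z); parked, not closed — `ledger route dormant route-FinalStateConjecture-NoVacuumStrings --off` to reactivate) — unstaffed, not closed; items shared with open routes are served there. `ledger route dormant <id> --off` reactivates.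

# Route NoVacuumStrings — no strings on the vacuum — singularity models at a first naked point have
isometry-fixed tips; strings are trapped or disperse

It suffices to show X = NakedModelExists ∧ LonelyNakedTips ∧ LonelyTipTameExit ∧
CensoredDataTameExit (with the shared item
MGHDExistence — the Statement's anti-vacuity conjunct ∃ MGHD, = the Choquet-Bruhat–Geroch named fact
restricted to admissible
data, stated inline so that no fact module enters the import cone; a hypothesis of `closes`, hence
badged CRUX (rank 9) since
rev 3, 2026-08-16, under the crux-only glue invariant). RE-TYPED 2026-08-16 for the T2 summit
(p126844: TAME genericity
`IsTameChristodoulouGeneric` on one fixed end, honest near-zone radii, chart time orientation,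
intrinsic lower bound on the
settled region): the two EXIT cruxes now deliver TAME, IMMERSED exit curves on ONE fixed
asymptotically flat end whose small
members are good in the re-typed sense (LonelyTipTameExit / CensoredDataTameExit supersede
LonelyTipExit stmt-12916 /
CensoredDataExit stmt-9936 in this route), and the local-to-global reparametrisation of exit curves
(formerly the shared support
LocalExitSuffices, then an inlined arctan squash) is the sorry-free Literature lemma
`InitialDataSet.isTameChristodoulouGeneric_of_local` (TameGenericityLocal.lean: radial contraction
into the ε-ball preserves
tameness, immersion, injectivity), so `closes` is pure logic. Card realised:
no-vacuum-strings-symmetry-rank-census (spine). The naked half of the exceptional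
set is cut BY THE SYMMETRY RANK OF THE SINGULARITY MODEL. A singularity model at a first naked point
P of an MGHD 𝒟 is a C²
blow-up limit (𝓩, P₀) of 𝒟 at P (prelude `Spacetime.IsTangentProfileAt … 2`) whose marked past P₀ is
a MINIMAL TIP of 𝓩 (the
tip of the model is a first ideal point of the model) and whose metric is non-flat. NakedModelExists
(card K2): every MGHD of
admissible data with incomplete sojourn-𝓘⁺ has a first naked point carrying such a model.
LonelyNakedTips (the RANK GAP, card
K3 + K1 + P1 folded into one typed theorem about ALL admissible data): every Killing orbit of every
such model that starts in
P₀ stays in P₀ — no continuous isometry of the model moves its tip, i.e. the visible singularity is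
an ISOLATED POINT, not a
string (spacelike translation), sheet or closed loop of tips (symmetry rank 0). LonelyTipTameExit
(card K4, the rank-0 handoff,
imported from the tangent-profile programme): a first naked point with a model, all models of the
datum being lonely, forces a
local good TAME exit curve. CensoredDataTameExit is the final-state half at censored data in the
same tame local form (the tame
re-typing of the Kerr-basin routes' CensoredDataExit).
Lean: `MGHDExistence ∧ NakedModelExists ∧ LonelyNakedTips ∧ LonelyTipTameExit ∧
CensoredDataTameExit`

## Assembly
Pure logic, sorry-free in Sketch.lean / glue.lean (`theorem closes`; axioms propext,
Classical.choice, Quot.sound): fix X; by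
`InitialDataSet.isTameChristodoulouGeneric_of_local` it suffices to produce, through every
exceptional admissible D, one AF end
e and a tame (on e), immersed, injective family F of admissible data with F 0 = D whose members with
0 < ‖c‖ < ε are good; if
every MGHD of D has complete 𝓘⁺, MGHDExistence (crux #9) and exceptionality give a maximal
development without the summit's
settling clause (sub-extremal Kerr decomposition d of O = exteriorOf 𝒟 d.charted with
RaysStayInClosure, HasExhaustiveCharts,
IsFutureOriented) and CensoredDataTameExit the exit; otherwise NakedModelExists gives a first naked
point with a model,
LonelyNakedTips (specialised to D) the loneliness of all models of D, and LonelyTipTameExit the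
exit. No named Literature fact
enters the cone (TameGenericityLocal / TameGenericityDiagonal are proved bookkeeping over
TameGenericity, which the Statement
already imports); the five hypotheses of `closes` are exactly the five cruxes, and the `Assembly`
item is the ranked crux chain
`LonelyNakedTips → NakedModelExists → LonelyTipTameExit → CensoredDataTameExit → MGHDExistence →
FinalStateConjecture`, the type
of `closes` up to the order of its binders.

Rationale: WHY THIS LINE. Mechanism (card, an INVERSION of the censorship conjunct): every arena in which
censorship is known to fail robustly produces an
EXTENDED visible singularity — the rank-1 string of the 5D Gregory–Laflamme pinch-off
(arXiv:1106.5184), matter spindles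
(doi:10.1103/physrevlett.66.994, arXiv:1611.07906) — while the fine-tuned vacuum examples
(RodnianskiShlapentokhRothman2023) are
points; so classify blow-up models at a first visible singular point by the TRANSLATION part of
their isometry group (White /
Cheeger–Naber stratification of singular sets by the translation-invariance of tangent objects,
doi:10.1515/crll.1997.488.1,
doi:10.4007/annals.2015.182.3.5, transplanted to Lorentzian blow-up limits at ideal points,
MorganTian2007 Def 5.3/5.32) and kill
every positive rank with the large-data theory of the REDUCED equations: a model with a spacelike
Killing translation is 2+1
gravity coupled to a wave map into ℍ² (Geroch 1971; Moncrief doi:10.1016/s0003-4916(86)80009-4);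
either its transverse energy per
unit Killing length reaches the 2π deficit — the transverse slices close up (Deser–Jackiw–'t Hooft
doi:10.1016/0003-4916(84)90085-x),
the Killing orbits lie on closed trapped surfaces and the point is not visible (hoop branch; Ida
doi:10.1103/physrevlett.85.3758:
2+1 gravity has no black holes) — or it is sub-critical, where equivariant regularity and scattering
are theorems
(arXiv:1501.00616, arXiv:2204.01157, arXiv:1311.4495) and the general AF U(1) problem is Moncrief's;
rank 2 is the Einstein–
Belinski–Zakharov/cylindrical rung where AF vacuum forms neither trapped surfaces nor singularities
(arXiv:gr-qc/9404005,
doi:10.1007/s00023-026-01667-2) and colliding plane waves crunch behind horizons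
(doi:10.1103/physrevd.98.084053); rank 3 is
Kasner. Imported areas: geometric measure theory (dimension reduction of singular strata),
energy-critical dispersive PDE
(wave maps into ℍ²), 2+1 gravity (conical geometry, Gauss–Bonnet), the hoop heuristic as an energy
CAP on naked strings. What the
typed layer adds to the tangent-profile routes (TangentProfileCensorship, HomotheticSurfaceGravity),
which ASSUME a point with a
self-similar profile: 'the naked singularity is an isolated point' becomes a theorem-schema
(LonelyNakedTips, typed today over
`IsTangentProfileAt`, `IsMinimalTIP`, `IsKillingField`, `IsMIntegralCurveOn` — no self-similarity
assumed), and NakedDataExit is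
decomposed into compactness (NakedModelExists) + rank gap + a strictly weaker rank-0 exit;
CurvatureOrSymmetry's 'symmetry' is a
Killing horizon shadow on the incomplete ray (bounded-curvature fountain), a different object.
Negatives index: empty.

RANKED CRUXES. #2 LonelyNakedTips (crux) — RANK GAP / LONELY NAKED TIPS (card K3 + K1 + P1(b), ALL
admissible data, no genericity): for every admissible datum D, every maximal vacuum Cauchy
development 𝒟 of D, every first naked point P of 𝒟 (TIP, visible from infinity, minimal), every C²
tangent profile (𝓩, P₀) of 𝒟 at P with P₀ a minimal TIP of 𝓩 and 𝓩 non-flat (granted its Levi-Civita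
connection), every Killing field K of 𝓩 and every integral curve γ of K on [0, t] (either sign of
t): γ 0 ∈ P₀ ⇒ γ t ∈ P₀. In words: no continuous isometry of a singularity model at a first naked
point moves the tip — the model carries no spacelike Killing TRANSLATION (a string of tips), no
closed loop of tips, no timelike or null translation; rotations and boosts FIXING the tip (rank 0)
are allowed. The card's dichotomy proves it in schema: closed transverse slices ⇒ trapped Killing
orbits ⇒ P not visible; sub-critical transverse energy ⇒ the U(1)-reduced 2+1 Einstein–wave-map(ℍ²)
solution is globally regular (Type I impossible); Kasner/plane-wave ranks 2–3 have infinite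
transverse energy (closed branch). [difficulty: open-problem] (why it might fail: Leans on
Moncrief's LARGE-data AF U(1) problem (open; only equivariant/small data known) and on censoring the
closed branch, whose transverse sphere may be ANTI-trapped or Kasner-like with non-compact orbits;
one admissible datum with a visible simultaneous line singularity refutes it.) [arXiv:gr-qc/9404005,
doi:10.1016/s0003-4916(86)80009-4, arXiv:1501.00616, arXiv:2204.01157, arXiv:1311.4495,
doi:10.1103/physrevlett.85.3758, doi:10.1016/0003-4916(84)90085-x, arXiv:0712.3907, arXiv:1106.5184,
doi:10.4007/annals.2015.182.3.5]
#3 NakedModelExists (crux) — NAKED MODEL EXISTS (card K2, blow-up compactness at a first visible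
singular point): for every admissible datum D and every maximal vacuum Cauchy development 𝒟 of D
with INCOMPLETE future null infinity (sojourn form) there is a first naked point P of 𝒟 (a TIP,
visible from the rays witnessing the incompleteness, minimal among TIPs) and a C² tangent profile
(𝓩, P₀) of 𝒟 at P — scales ƛₙ ↓ 0, eventual time-oriented open embeddings ψₙ with ƛₙ⁻²ψₙ^*g → g_𝓩 in
C²_loc, centred: ψₙ⁻¹(P) → P₀ — such that P₀ is a MINIMAL TIP of 𝓩 (the model's tip is a first ideal
point of the model: honest centring, no punctures inside the past of the tip) and 𝓩 is non-flat.
Point-picking at the curvature scale, a gauge controlled by curvature bounds, unwrapping of collapse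
(local covers are allowed by `IsTangentProfileAt`), and the causal-boundary theorem 'incomplete
sojourn-𝓘⁺ ⇒ a first naked TIP exists' are its content. [difficulty: open-problem] (why it might
fail: No Lorentzian Cheeger–Gromov compactness from curvature bounds alone (lapse/injectivity
collapse; bounded-L² theory continues, does not converge); Type-II concentration yields only models
centred at P₀ = 𝓩, never a minimal TIP; a bounded-curvature naked boundary (fountain) has only flat
models.) [MorganTian2007, RodnianskiShlapentokhRothman2023, arXiv:gr-qc/0208079, arXiv:1204.1767,
HawkingEllis1973CUP, arXiv:2601.04152]
#4 LonelyTipTameExit (crux) — LONELY TIP TAME EXIT (card K4, the rank-0 handoff; tame re-typing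
2026-08-16 of LonelyTipExit stmt-12916, dropped from this route): for every admissible datum D,
maximal development 𝒟, first naked point P of 𝒟 carrying a non-flat C² singularity model centred at
a minimal TIP, IF every such model at every first naked point of every MGHD of D is lonely
(conclusion of LonelyNakedTips for D), THEN there are ONE asymptotically flat end e of X and a
one-parameter family F of admissible data, TAME on e (jointly smooth; e the sole end; DR rates with
continuous mass; wDist-continuous at c = 0), IMMERSED at 0, injective, F 0 = D, and ε > 0 such that
for 0 < ‖c‖ < ε the datum F c is good in the re-typed sense (has an MGHD; every MGHD has complete 𝓘⁺
and a sub-extremal Kerr final-state decomposition of O = exteriorOf with RaysStayInClosure,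
HasExhaustiveCharts (honest radii) and IsFutureOriented). The loneliness hypothesis makes the
self-similar census of the tangent-profile programme without loss of generality (isolated, maximally
asymmetric tips); the exit itself is that programme's smooth-class instability + finitely many naked
points + basin landing, along a line of FIXED asymptotics (Christodoulou's α₀ + c f, CQG 16 p. A24).
[deps: LonelyNakedTips, NakedModelExists] [difficulty: open-problem] (why it might fail: Still the
tangent-profile programme at rank 0 (profile census; smooth-class instability vs arXiv:2605.16235
threshold-STABLE naked singularities; large-data Kerr settling incl.
RaysStayInClosure/IsFutureOriented), now along a TAME curve: the kick must keep DR rates on one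
fixed end and be immersed.) [Christodoulou1999instability, Christodoulou1999,
RodnianskiShlapentokhRothman2023, arXiv:2605.16235, arXiv:2605.16095, An2025, LiLiu2022,
arXiv:0811.0354, DafermosLuk2017]
#5 CensoredDataTameExit (crux) — CENSORED DATA TAME EXIT (the final-state half at censored data,
local TAME form; re-typing 2026-08-16 of the shared CensoredDataExit stmt-9936, dropped from THIS
route and kept by TangentProfileCensorship / CurvatureOrSymmetry / HomotheticSurfaceGravity): for
every X and every admissible datum D which has an MGHD, all of whose MGHDs have complete 𝓘⁺, but
some MGHD of which carries no sub-extremal Kerr final-state decomposition d of O = exteriorOf 𝒟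
d.charted with RaysStayInClosure ∧ HasExhaustiveCharts ∧ IsFutureOriented (the summit's settling
clause verbatim), there are one AF end e of X, a one-parameter family F of admissible data tame on
e, immersed at 0, injective, F 0 = D, and ε > 0 with F c good (summit clause verbatim) for 0 < ‖c‖ <
ε. [difficulty: open-problem] (why it might fail: Needs Kerr stability for LARGE censored data
(printed reach |a| ≪ M, KlainermanSzeftel2023) and non-genericity of extremal / many-hole /
non-settling end states along a TAME line (fixed end, continuous mass; KehleUnger2025); a censored
datum in a Cantor-like threshold lamination has no exit.) [DafermosLuk2017, KlainermanSzeftel2023,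
GiorgiKlainermanSzeftel2022, DafermosHolzegelRodnianskiTaylor2021, KehleUnger2025,
AngelopoulosKehleUnger2024, Christodoulou1999, arXiv:0811.0354]
#9 MGHDExistence (crux, rank 9; re-badged support→crux at rev 3, 2026-08-16, because it is a
hypothesis of `closes` and the layer invariant admits only crux items there — it is the Statement's
anti-vacuity conjunct ∃ MGHD, which none of the cruxes #2–#5 yields since they all quantify OVER
maximal developments, and it cannot be discharged inside the proof term) — every admissible datum
has a maximal globally hyperbolic vacuum development, stated over the repaired structure
`VacuumCauchyDevelopment` (Choquet-Bruhat–Geroch 1969 Thm 3, Sbierski 2016 Thm 2.6; = the named fact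
`choquetBruhat_geroch_exists_mghd_cauchy` restricted to admissible data, one line from
`forall_mem_admissibleVacuumData` once the fact is proved, stated inline so that the fact module
stays out of the import cone); shared by fifteen routes of this summit, tier-0 formalisation debt.
[difficulty: XL] (why it might fail: known in print but unproved here and typing-exposed —
`IsMaximal` makes EVERY `VacuumCauchyDevelopment.{0}` of D embed into one 𝒟, so one rogue typed
development falsifies it, as the first rendering over `VacuumDevelopment` died
(`VacuumDevelopment.isEmpty`).) [ChoquetBruhatGeroch1969CMP, Sbierski2016AHP, Ringstrom2009]
(Local-to-global: the former shared support LocalExitSuffices — proved as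
Theorems.LocalExitSuffices_proof @00fcba88798a, dropped from this route in the 2026-08-16 cone
repair — and its inlined arctan successor are replaced, since the re-type, by the sorry-free
Literature lemma `InitialDataSet.isTameChristodoulouGeneric_of_local`
(Literature/Geometry/Lorentzian/TameGenericityLocal.lean: radial contraction c ↦ ε(1+‖c‖²)^{-1/2}c
preserves `IsTameDataFamily` (`comp_contDiff`), `IsImmersedAtZero` (`comp_of_injective_fderiv`,
differential ε·id), injectivity, admissibility and F 0), whose import closure TameGenericityDiagonal
→ TameGenericity carries no named fact.) [Christodoulou1999, Christodoulou1999instability]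

TWO-LAYER PLAN. Foreseen glued splits (filed later, once the definitions U1Reduction /
TransverseEnergy land; informal items now): LonelyNakedTips ⇐
ClosedStringsTrapped → SubcriticalStringsDisperse → LonelyNakedTips, where ClosedStringsTrapped
(card K3) = a model at a first naked
point with a tip-moving Killing field K whose transverse energy per unit Killing length reaches the
2π deficit has compact maximal
transverse slices, hence closed future-trapped 2-surfaces ≈ S²_⊥ × {z} near pₙ in (M, g), hence P is
not visible (closed trapped
surfaces of an MGHD of AF data do not meet J⁻ of the far rays); SubcriticalStringsDisperse (card K1,
Moncrief's U(1) problem at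
sub-critical energy) = the U(1) reduction of a sub-critical model is a finite-energy 2+1
Einstein–wave-map(ℍ²) solution which is
globally regular with energy-dependent bounds and disperses, so it cannot be tangent at a singular
tip; the glue is the transverse-
energy dichotomy plus 'null/timelike translations contradict firstness'. NakedModelExists ⇐
FirstNakedTIP → CurvatureScaleCompactness
→ NakedModelExists (causal-boundary theorem; point-picking + gauge + unwrapping + exactness).
LonelyTipTameExit shares the foreseen split of
NakedDataExit in TangentProfileCensorship (extraction → smooth-class instability → quantisation),
with loneliness as an extra hypothesis.

KILL CRITERIA. LonelyNakedTips refuted by an honest model — an admissible datum whose MGHD has a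
first naked point with a non-flat minimal-TIP-centred
C² model and a Killing orbit leaving P₀ (a visible vacuum string: e.g. a large-data AF U(1) blow-up,
or a visible Kasner spike) —
kills the card's thesis: close `refuted:LonelyNakedTips` and hand the witness to the tangent-profile
routes as a new species. Refuted
only through a typing artefact (a punctured or re-centred model slipping past the minimal-TIP /
non-flat guards): misstated — add the
repaired item LonelyNakedTipsR over the corrected model class and re-certify the glue.
NakedModelExists refuted by a Type-II-only or
bounded-curvature (fountain) naked boundary: pivot — add the eternal-model branch (card K1(iii):
complete non-flat models with a
nowhere-vanishing spacelike Killing field disperse) or import NoVacuumFountains from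
CurvatureOrSymmetry. CensoredDataTameExit refuted:
the typed summit's settling conjunct fails for every censorship-spined route alike; close.
NakedDataExit proved elsewhere (any
mechanism, in tame form) moots LonelyTipTameExit and NakedModelExists for FSC purposes (route
superseded), LonelyNakedTips staying of independent interest.

NOT DECOMPOSED YET. The transverse-energy dichotomy and its threshold E* (needs the definitions
U1Reduction, TransverseEnergy: Geroch–Moncrief quotient,
norm and twist potentials, target dγ² + ¼e^{−4γ}dω²); the closure lemma (Cohn-Vossen / Gauss–Bonnet
on maximal transverse slices,
R⁽²⁾ = 16πρ + |k|² ≥ 0) and 'closed trapped surfaces are invisible'; the Liouville lemmas of card P1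
(finite-energy harmonic maps
ℝ² → ℍ² are constant; vacuum pp-waves singular on a null line are sourced; Geroch–Moncrief reduction
algebra — provable-now supports to
be attached with `--supports LonelyNakedTips`); EXACTNESS (almost-Killing at scale ⇒ Killing field
of the limit, `killingDefectCk`);
Type-II / eternal models (P₀ = 𝓩, outside the minimal-TIP class by design); the rank-0 census itself
(other routes); all constants.

CHEAPEST FALSIFIER. Literature, one afternoon: (i) is there ANY asymptotically flat vacuum
development (numerical or exact) whose curvature blow-up is, at
its own scale, invariant under a spacelike translation and visible — prolate Brill-wave collapse
(arXiv:0802.3791: black hole, not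
spindle; consistent), AF cylindrical vacuum (arXiv:gr-qc/9404005: no trapped surfaces AND no
singularities; consistent), colliding
plane waves (doi:10.1103/physrevd.98.084053: horizons form; consistent), 5D (arXiv:1106.5184: the
generic violation IS a string;
consistent with the dictionary); (ii) for SubcriticalStringsDisperse: a finite-energy self-similar
or Type-II blow-up of the 2+1
equivariant Einstein–wave-map(ℍ²) system would kill the sub-critical branch — arXiv:1311.4495 /
arXiv:1501.00616 / arXiv:2204.01157
prove non-concentration, regularity and scattering in the equivariant class (does not fire); (iii)
the card's kit job j003201
(momentarily static rods, NST family): horizons appear WHOLE at the scale-free density μ_c =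
0.68875, birth aspect C_eq/C_pol = 0.44,
never as thin sheaths — the hoop cap of the closed branch behaves as claimed (does not fire).

NUMBERS. Deficit threshold of the closed branch: total transverse energy E* ↔ conical deficit 2π
(doi:10.1016/0003-4916(84)90085-x); rod
threshold μ_c = 0.68875 ± 10⁻⁶ (bare density, G = c = 1), A/16πM² = 0.966 at threshold (card, kit
j003201); Gregory–Laflamme: Sch₄ × S¹_R
unstable for R > 4M, growth μ > 1/(40√10 M) (barrier file); Kasner exponents Σpᵢ = Σpᵢ² = 1 (rank 3,
one expanding direction);
equivariant Einstein–wave-map: global regularity for all energies (arXiv:1501.00616), scattering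
(arXiv:2204.01157). Items at open: 7
typed (4 cruxes, 2 supports, 1 assembly) + 2 informal supports + 2 definition requests to file;
after the 2026-08-16 cone repair (rev 2) and re-badge (revs 3–7): 5 cruxes (ranks 2–5 and 9,
MGHDExistence re-kinded crux) + 2 informal supports + 1 assembly (restated at rev 7 as the crux
chain in rank order); `closes` over exactly the five cruxes; after the 2026-08-16 RE-TYPE repair
(statement-revised p126844): the two exit cruxes re-filed TAME (LonelyTipTameExit r4,
CensoredDataTameExit r5; LonelyTipExit 12916 / CensoredDataExit 9936 dropped from this route),
Assembly restated, `closes` re-derived through `isTameChristodoulouGeneric_of_local` — still 5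
cruxes + 2 informal supports + 1 assembly.

DEFINITION REQUESTS. D1 `U1Reduction` (Literature/Geometry/Lorentzian): for a spacetime (Z, g) with
a nowhere-vanishing spacelike Killing field K, the
Geroch–Moncrief quotient data — norm e^{2γ} = g(K,K), twist 1-form / potential ω (vacuum), quotient
Lorentzian 3-metric
g₃ = e^{2γ}(g − e^{−2γ}K♭⊗K♭) on the orbit space where it is a manifold, and the identity Ric(g) = 0
⇔ (g₃ Einstein–wave-map with
target metric dγ² + ¼e^{−4γ}dω², curvature −4) (Geroch JMP 12 (1971) 918; Moncrief
doi:10.1016/s0003-4916(86)80009-4). D2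
`TransverseEnergy` (same topic): the reduced wave-map + gravitational energy of a transverse
spacelike 2-slice of the quotient per
unit Killing length, and its deficit-angle normalisation (E* ↔ 2π). Both filed with `ledger workitem
add --kind definition` after
open, `--for` the informal items ClosedStringsTrapped / SubcriticalStringsDisperse. No cite facts
requested at open (the cone of the
typed items contains prelude definitions only).

Novelty: Searches (2026-08-15; local searchd rc 75 and OpenAlex 429 during the session, arXiv leg + galaxy +
citation map used): `lit search --source arxiv "U(1) symmetric vacuum Einstein"` (15:
Choquet-Bruhat–Isenberg–Moncrief T³ AVTD, Huneau–Luk arXiv:2506.21779, Gudapati arXiv:2204.01157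
scattering for the equivariant U(1) problem); `"Einstein wave map"` (15: arXiv:1501.00616,
arXiv:1511.09371, arXiv:1311.4495, arXiv:1703.06331); `"spindle singularity"` (15: arXiv:1611.07906
collisionless spindle collapse, arXiv:1102.2090 5D); `"cosmic censorship cylindrical symmetry
vacuum"` (2: arXiv:gr-qc/9404005, arXiv:gr-qc/0503098); `"self-gravitating wave maps"` (12:
arXiv:1311.4495); two longer arXiv queries (0 each); `lit galaxy search --star all "Killing vector
blow-up limit singularity"` (0) and `"hoop conjecture"` (16: Baumgarte–Shapiro, Joshi
panama:378420978515983, Pretorius–East doi:10.1103/physrevd.98.084053, Yoshino arXiv:1909.08420);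
`lit frontier FinalStateConjecture --since 2022` (30: arXiv:2601.04152 visibility obstructions,
doi:10.1007/s00023-026-01667-2 Einstein–Belinski–Zakharov solitons, arXiv:2412.09540); `lit bridges
FinalStateConjecture --cross any` (30, surveys); the card's own search log (arXiv ×11, crossref,
zbMATH, galaxy intelligent) and the refuter's novelty audit of the card (grade new-combination;
uncited template White doi:10.1515/crll.1997.488.1, Anderson arXiv:gr-qc/0208079 p. 13).
Nearest prior art found: doi:10.1515/crll.1997.488.1 and doi:10.4007/annals.201  [refs: 10.1103/physrevd.98.084053, 10.1007/s00023-026-01667-2, 10.1515/crll.1997.488.1, 10.4007/annals.2015.182.3.5, 2506.21779, 2204.01157, 1501.00616, 1511.09371, 1311.4495, 1703.06331, 1611.07906, 1102.2090, gr-qc/9404005, gr-qc/0503098, 1909.08420, 2601.04152, 2412.09540, gr-qc/0208079, doi:10.1103/physrevd.98.084053, doi:10.1007/s00023-026-01667-2, doi:10.1515/crll.1997.488.1, doi:10.4007/annals.201]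

Barriers (technique_class: blowup-rescaling, symmetry-reduction, hoop): - technique_class: blowup-rescaling, symmetry-reduction, hoop
- Literature.Barriers.FinalStateConjecture.GregoryLaflammeInstability: evaded — the load-bearing
inputs of LonelyNakedTips ('2+1 gravity has no black holes', target curvature −1, Gauss–Bonnet
closure at deficit 2π) are specific to d = 4 and visibly false one dimension up, where the card's
dictionary (rank-1 reduction of 5D vacuum = 3+1 Einstein–Maxwell–dilaton) reproduces the barrier's
own phenomenon, the GL string pinch-off (arXiv:1106.5184); nothing in the line is flat-factor-blind.
- Literature.Barriers.FinalStateConjecture.nakedSingularityInstability: consistent — LonelyNakedTips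
excludes only EXTENDED visible singularities and does so for all data (no genericity claim is drawn
from it); fine-tuned rank-0 points (Christodoulou, RSR, Zheng's threshold-stable profiles) survive
and carry the genericity clause inside LonelyTipExit / CensoredDataExit, which produce transversal
curves datum by datum (`IsChristodoulouGeneric … 1` shape), smooth class only.
- Literature.Barriers.FinalStateConjecture.IonescuKlainermanNonExtension: not engaged — no Killing
field is extended across a horizon or continued uniquely inside one smooth spacetime; the Killing
fields of the line live on blow-up LIMITS (exactness: almost-symmetries at scale converge to
symmetries of the model, a compactness statement), and the reduction is applied on the model, where
K is given.
- Literature.Barriers.FinalStateConjecture.SlowlyRotatingKerrFrontie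

History (route lifecycle, newest last):
- 2026-08-16T20:50:03Z · rev 2: dropped LocalExitSuffices — cone repair (route-repair seat, 2026-08-16): both unproved facts in the IMPORT cone (choquetBruhat_geroch_exists_mghd_cauchy XL, Minkowski.isCauchySurface_range (planner-rrepair-FinalStateConjecture-NoVacuumS-0e2f79b6-0)
- 2026-08-16T21:07:04Z · rev 7: restated Assembly (stmt-FinalStateConjecture-16802) — re-badge (cont.): restate the Assembly item as the crux chain in RANK order (LonelyNakedTips → NakedModelExists → LonelyTipExit → CensoredDataExit → MGHDExisten (planner-rbadge-FinalStateConjecture-NoVacuumSt-0e2f79b6-0)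
- 2026-08-16T23:16:56Z · rev 8: restated Assembly (stmt-FinalStateConjecture-16814) — route-repair (statement-revised p126844, re-type T2): the two EXIT cruxes re-filed TAME — LonelyTipTameExit (r4) / CensoredDataTameExit (r5): ∃ one AF end e, a (planner-rrepair-FinalStateConjecture-NoVacuumS-6c2334be-0)
- 2026-08-16T23:16:56Z · rev 8: dropped LonelyTipExit, CensoredDataExit — route-repair (statement-revised p126844, re-type T2): the two EXIT cruxes re-filed TAME — LonelyTipTameExit (r4) / CensoredDataTameExit (r5): ∃ one AF end e, a (planner-rrepair-FinalStateConjecture-NoVacuumS-6c2334be-0)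
- 2026-08-16T23:47:49Z · rev 10: restated Assembly (stmt-FinalStateConjecture-17357) — route-repair g2 (glue stamp, cont.): the closes-only re-submission (rev 9) was recorded provisional/textual without a farm elaboration (known symptom of closes- (planner-rbadge-FinalStateConjecture-NoVacuumSt-0e2f79b6-g2-0)
- 2026-08-24T06:15:53Z · DORMANT — reconciler: no traction for 6.6 d (last activity item-evidence-added at 2026-08-17T15:45:33Z); parked, not closed — `ledger route dormant route-FinalStateConjec (operator:999:3631115)
- 2026-08-30T17:07:32Z · REACTIVATED (open) — reconciler: reactivated — activity statement-checked at 2026-08-30T15:54:01Z after parking at 2026-08-24T06:15:53Z (operator:999:456465)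
- 2026-09-04T18:32:06Z · DORMANT — reconciler: no traction for 5 d (last activity statement-checked at 2026-08-30T17:35:43Z); parked, not closed — `ledger route dormant route-FinalStateConjecture (operator:999:2105588)

sub-problem: FinalStateConjecture · status: dormant · opened planner-plancard-FinalStateConjecture-FinalSt-b9c19436-0 2026-08-15T18:59:27Z · rev 10 · ledger route-FinalStateConjecture-NoVacuumStrings
GENERATED by the gate from the ledger (D-0016/17). Provers cite these decls: `theorem foo : Summit.FinalStateConjecture.FinalStateConjecture.Theses.NoVacuumStrings.<Decl> := …` in Summits/FinalStateConjecture/FinalStateConjecture/Theorems/<Name>.lean.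
-/

namespace Summit.FinalStateConjecture.FinalStateConjecture.Theses.NoVacuumStrings

open scoped BigOperators Topology Manifold Classical MeasureTheory ProbabilityTheory Matrix InnerProductSpace ComplexConjugate ContinuousMap
open Filter Set Function TopologicalSpace MeasureTheory

attribute [summit_statement] _root_.FinalStateConjecture

/-! Retired items kept as plain definitions (history; not obligations of this route): landed proofs / closed glue still name them. -/

-- tombstone: stmt-FinalStateConjecture-9938 was DROPPED from this route but is still named by active items / landed proofs — kept as a plain def (no route_item tag), not an obligation of this route
/-- retired stmt-FinalStateConjecture-9938 (dropped, gen None) — proved by Summit.FinalStateConjecture.FinalStateConjecture.Theorems.LocalExitSuffices_proof @ 442927d8e260. -/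
def LocalExitSuffices : Prop :=
  ∀ (X : Type) [TopologicalSpace X] [ChartedSpace Literature.Geometry.Lorentzian.E3 X] [IsManifold (𝓡 3) ((⊤ : ℕ∞) : WithTop ℕ∞) X] [T2Space X] [SecondCountableTopology X] [ConnectedSpace X] (𝓔 : Set (Literature.Geometry.Lorentzian.InitialDataSet (𝓡 3) X)) (D : Literature.Geometry.Lorentzian.InitialDataSet (𝓡 3) X), (∃ F : EuclideanSpace ℝ (Fin 1) → Literature.Geometry.Lorentzian.InitialDataSet (𝓡 3) X, Literature.Geometry.Lorentzian.InitialDataSet.IsSmoothDataFamily 1 F ∧ F 0 = D ∧ Function.Injective F ∧ (∀ c, F c ∈ Literature.Geometry.Lorentzian.admissibleVacuumData X) ∧ ∃ ε : ℝ, 0 < ε ∧ ∀ c, c ≠ 0 → ‖c‖ < ε → F c ∉ 𝓔) → ∃ F : EuclideanSpace ℝ (Fin 1) → Literature.Geometry.Lorentzian.InitialDataSet (𝓡 3) X, Literature.Geometry.Lorentzian.InitialDataSet.IsSmoothDataFamily 1 F ∧ F 0 = D ∧ Function.Injective F ∧ (∀ c, F c ∈ Literature.Geometry.Lorentzian.admissibleVacuumData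 X) ∧ ∀ c, c ≠ 0 → F c ∉ 𝓔

/-- item stmt-FinalStateConjecture-12914 · crux · rank 2 · open · by planner
why it might fail: Rests on Moncrief's LARGE-data AF U(1) problem (open; equivariant only, arXiv:1501.00616) and a heuristic hoop cap for the closed branch; TIPs on a spacelike singular boundary are all minimal, so one datum with a visible Kasner-like sheet or off-axis ring blow-up (rotation -> translation) kills it.
sources: doi:10.1016/s0003-4916(86)80009-4, arXiv:1501.00616, arXiv:2204.01157, arXiv:1311.4495, arXiv:gr-qc/9404005, doi:10.1103/physrevlett.85.3758
[crux] RANK GAP / LONELY NAKED TIPS (card K3 + K1 + P1(b), ALL admissible data, no genericity): for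
every admissible datum D, every maximal vacuum Cauchy development 𝒟 of D, every first naked point P
of 𝒟 (TIP, visible from infinity, minimal), every C² tangent profile (𝓩, P₀) of 𝒟 at P with P₀ a
minimal TIP of 𝓩 and 𝓩 non-flat (granted its Levi-Civita connection), every Killing field K of 𝓩 and
every integral curve γ of K on [0, t] (either sign of t): γ 0 ∈ P₀ ⇒ γ t ∈ P₀. In words: no
continuous isometry of a singularity model at a first naked point moves the tip — the model carries
no spacelike Killing TRANSLATION (a string of tips), no closed loop of tips, no timelike or null
translation; rotations and boosts FIXING the tip (rank 0) are allowed. The card's dichotomy proves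
it in schema: closed transverse slices ⇒ trapped Killing orbits ⇒ P not visible; sub-critical
transverse energy ⇒ the U(1)-reduced 2+1 Einstein–wave-map(ℍ²) solution is globally regular (Type I
impossible); Kasner/plane-wave ranks 2–3 have infinite transverse energy (closed branch).
[difficulty: open-problem] -/
@[route_item "route-FinalStateConjecture-NoVacuumStrings"]
def LonelyNakedTips : Prop :=
  ∀ (X : Type) [TopologicalSpace X] [ChartedSpace Literature.Geometry.Lorentzian.E3 X] [IsManifold (𝓡 3) ((⊤ : ℕ∞) : WithTop ℕ∞) X] [T2Space X] [SecondCountableTopology X] [ConnectedSpace X], ∀ D ∈ Literature.Geometry.Lorentzian.admissibleVacuumData X, ∀ 𝒟 : Literature.Geometry.Lorentzian.VacuumCauchyDevelopment D, 𝒟.IsMaximal → ∀ P : Set 𝒟.carrier, 𝒟.toCauchyDevelopment.FirstNakedPoint P → ∀ (𝓩 : Literature.Geometry.Lorentzian.Spacetime.{0} 4) (P₀ : Set 𝓩.carrier), Literature.Geometry.Lorentzian.Spacetime.IsTangentProfileAt 𝒟.toSpacetime P 𝓩 P₀ 2 → 𝓩.metric.IsMinimalTIP 𝓩.timeOrientation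 P₀ → ∀ [𝓩.metric.HasLeviCivita], ¬ 𝓩.metric.leviCivita.IsFlat → ∀ (K : Π x : 𝓩.carrier, TangentSpace (𝓡 4) x) (γ : ℝ → 𝓩.carrier) (t : ℝ), 𝓩.metric.IsKillingField K → IsMIntegralCurveOn γ K (Set.uIcc 0 t) → γ 0 ∈ P₀ → γ t ∈ P₀

/-- item stmt-FinalStateConjecture-12915 · crux · rank 3 · open · by planner
why it might fail: No Lorentzian Cheeger-Gromov compactness from curvature control (lapse/injectivity collapse; bounded-L2 theory continues, does not extract C2 limits); Type-II concentration re-centres the model so P0 is no minimal TIP; a bounded-curvature naked boundary (fountain) has only FLAT C2 models.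
sources: MorganTian2007, RodnianskiShlapentokhRothman2023, arXiv:gr-qc/0208079, arXiv:1204.1767, HawkingEllis1973CUP, arXiv:2601.04152
[crux] NAKED MODEL EXISTS (card K2, blow-up compactness at a first visible singular point): for
every admissible datum D and every maximal vacuum Cauchy development 𝒟 of D with INCOMPLETE future
null infinity (sojourn form) there is a first naked point P of 𝒟 (a TIP, visible from the rays
witnessing the incompleteness, minimal among TIPs) and a C² tangent profile (𝓩, P₀) of 𝒟 at P —
scales ƛₙ ↓ 0, eventual time-oriented open embeddings ψₙ with ƛₙ⁻²ψₙ^*g → g_𝓩 in C²_loc, centred: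
ψₙ⁻¹(P) → P₀ — such that P₀ is a MINIMAL TIP of 𝓩 (the model's tip is a first ideal point of the
model: honest centring, no punctures inside the past of the tip) and 𝓩 is non-flat. Point-picking at
the curvature scale, a gauge controlled by curvature bounds, unwrapping of collapse (local covers
are allowed by `IsTangentProfileAt`), and the causal-boundary theorem 'incomplete sojourn-𝓘⁺ ⇒ a
first naked TIP exists' are its content. [difficulty: open-problem] -/
@[route_item "route-FinalStateConjecture-NoVacuumStrings"]
def NakedModelExists : Prop :=
  ∀ (X : Type) [TopologicalSpace X] [ChartedSpace Literature.Geometry.Lorentzian.E3 X] [IsManifold (𝓡 3) ((⊤ : ℕ∞) : WithTop ℕ∞) X] [T2Space X] [SecondCountableTopology X] [ConnectedSpace X], ∀ D ∈ Literature.Geometry.Lorentzian.admissibleVacuumData X, ∀ 𝒟 : Literature.Geometry.Lorentzian.VacuumCauchyDevelopment D, 𝒟.IsMaximal → ¬ Summit.FinalStateConjecture.HasCompleteNullInfinity 𝒟.toCauchyDevelopment → ∃ P : Set 𝒟.carrier, 𝒟.toCauchyDevelopment.FirstNakedPoint P ∧ ∃ (𝓩 : Literature.Geometry.Lorentzian.Spacetime.{0}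 4) (P₀ : Set 𝓩.carrier), Literature.Geometry.Lorentzian.Spacetime.IsTangentProfileAt 𝒟.toSpacetime P 𝓩 P₀ 2 ∧ 𝓩.metric.IsMinimalTIP 𝓩.timeOrientation P₀ ∧ ∀ [𝓩.metric.HasLeviCivita], ¬ 𝓩.metric.leviCivita.IsFlat

/-- item stmt-FinalStateConjecture-17358 · crux · rank 4 · open · by planner
why it might fail: Still the tangent-profile programme at rank 0 (profile census; smooth-class instability vs arXiv:2605.16235 threshold-STABLE naked singularities; large-data Kerr settling incl. RaysStayInClosure/IsFutureOriented), now along a TAME curve: the kick must keep DR rates on one fixed end and be immersed.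
sources: Christodoulou1999instability, Christodoulou1999, RodnianskiShlapentokhRothman2023, arXiv:2605.16235, arXiv:2605.16095, An2025
[crux] LONELY TIP TAME EXIT (card K4, the rank-0 handoff; TAME re-typing 2026-08-16 of LonelyTipExit
stmt-FinalStateConjecture-12916 for the re-typed summit p126844, which it supersedes in this route):
for every admissible datum D, maximal development 𝒟, first naked point P of 𝒟 carrying a non-flat C²
singularity model centred at a minimal TIP, IF every such model at every first naked point of every
MGHD of D is lonely (conclusion of LonelyNakedTips for D), THEN there are ONE asymptotically flat
end e of X and a one-parameter family F of admissible data which is TAME on e (`IsTameDataFamily e 1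
F`: jointly smooth; e the sole end; every member Dafermos–Rodnianski-flat on e with continuous mass
M(c); e.wDist (F c) (F 0) → 0), IMMERSED at 0 (`IsImmersedAtZero 1 F`: dF/dc(0) a non-zero jet
field), injective, with F 0 = D, and ε > 0 such that for 0 < ‖c‖ < ε the datum F c is good in the
re-typed summit's sense (has an MGHD; every MGHD has complete 𝓘⁺ and a sub-extremal Kerr final-state
decomposition d in C² of O = exteriorOf 𝒟 d.charted with RaysStayInClosure (every future-complete
normalised null ray from Σ stays in closure O), HasExhaustiveCharts (honest growing near-zone radii,
certi -/
@[route_item "route-FinalStateConjecture-NoVacuumStrings"]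
def LonelyTipTameExit : Prop :=
  ∀ (X : Type) [TopologicalSpace X] [ChartedSpace Literature.Geometry.Lorentzian.E3 X] [IsManifold (𝓡 3) ((⊤ : ℕ∞) : WithTop ℕ∞) X] [T2Space X] [SecondCountableTopology X] [ConnectedSpace X], ∀ D ∈ Literature.Geometry.Lorentzian.admissibleVacuumData X, ∀ 𝒟 : Literature.Geometry.Lorentzian.VacuumCauchyDevelopment D, 𝒟.IsMaximal → ∀ P : Set 𝒟.carrier, 𝒟.toCauchyDevelopment.FirstNakedPoint P → (∃ (𝓩 : Literature.Geometry.Lorentzian.Spacetime.{0} 4) (P₀ : Set 𝓩.carrier), Literature.Geometry.Lorentzian.Spacetime.IsTangentProfileAt 𝒟.toSpacetime P 𝓩 P₀ 2 ∧ 𝓩.metric.IsMinimalTIP 𝓩.timeOrientation P₀ ∧ ∀ [𝓩.metric.HasLeviCivita], ¬ 𝓩.metric.leviCivita.IsFlat) → (∀ 𝒟₁ : Literature.Geometry.Lorentzian.VacuumCauchyDevelopment D, 𝒟₁.IsMaximal → ∀ P₁ : Set 𝒟₁.carrier, 𝒟₁.toCauchyDevelopment.FirstNakedPoint P₁ → ∀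 (𝓩 : Literature.Geometry.Lorentzian.Spacetime.{0} 4) (P₀ : Set 𝓩.carrier), Literature.Geometry.Lorentzian.Spacetime.IsTangentProfileAt 𝒟₁.toSpacetime P₁ 𝓩 P₀ 2 → 𝓩.metric.IsMinimalTIP 𝓩.timeOrientation P₀ → ∀ [𝓩.metric.HasLeviCivita], ¬ 𝓩.metric.leviCivita.IsFlat → ∀ (K : Π x : 𝓩.carrier, TangentSpace (𝓡 4) x) (γ : ℝ → 𝓩.carrier) (t : ℝ), 𝓩.metric.IsKillingField K → IsMIntegralCurveOn γ K (Set.uIcc 0 t) → γ 0 ∈ P₀ → γ t ∈ P₀) → ∃ (e : Literature.Geometry.Lorentzian.AFEnd X) (F : EuclideanSpace ℝ (Fin 1) → Literature.Geometry.Lorentzian.InitialDataSet (𝓡 3) X), Literature.Geometry.Lorentzian.InitialDataSet.IsTameDataFamily e 1 F ∧ Literature.Geometry.Lorentzian.InitialDataSet.IsImmersedAtZero 1 F ∧ F 0 = D ∧ Function.Injective F ∧ (∀ c, F c ∈ Literature.Geometry.Lorentzian.admissibleVacuumData X) ∧ ∃ ε : ℝ, 0 < ε ∧ ∀ c, c ≠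 0 → ‖c‖ < ε → ((∃ 𝒟' : Literature.Geometry.Lorentzian.VacuumCauchyDevelopment (F c), 𝒟'.IsMaximal) ∧ ∀ 𝒟' : Literature.Geometry.Lorentzian.VacuumCauchyDevelopment (F c), 𝒟'.IsMaximal → Summit.FinalStateConjecture.HasCompleteNullInfinity 𝒟'.toCauchyDevelopment ∧ ∃ (O : Set 𝒟'.carrier) (d : Literature.Geometry.Lorentzian.FinalStateDecomposition 𝒟'.toSpacetime O 2), (∀ i, Literature.Geometry.Lorentzian.Kerr.IsSubextremal (d.mass i) (d.spin i)) ∧ O = Summit.FinalStateConjecture.exteriorOf 𝒟'.toCauchyDevelopment d.charted ∧ Summit.FinalStateConjecture.RaysStayInClosure 𝒟'.toCauchyDevelopment O ∧ Summit.FinalStateConjecture.HasExhaustiveCharts d ∧ Summit.FinalStateConjecture.IsFutureOriented d)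

/-- item stmt-FinalStateConjecture-17348 · crux · rank 5 · open · by planner
why it might fail: Needs Kerr stability for LARGE censored data (printed reach |a| ≪ M, KlainermanSzeftel2023) and non-genericity of extremal / many-hole / non-settling end states along a TAME line (fixed end, continuous mass; KehleUnger2025); a censored datum in a Cantor-like threshold lamination has no exit.
sources: DafermosLuk2017, KlainermanSzeftel2023, GiorgiKlainermanSzeftel2022, DafermosHolzegelRodnianskiTaylor2021, KehleUnger2025, AngelopoulosKehleUnger2024
[crux] TAME CENSORED DATA EXIT (re-type T2 of the shared CensoredDataExit, Statement p126844,
2026-08-16; the final-state half at censored data, local form; offered verbatim to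
TangentProfileCensorship / HomotheticSurfaceGravity / NoVacuumStrings for re-attachment): for every
X as above and every admissible datum D which has an MGHD, all of whose MGHDs have complete 𝓘⁺, but
some MGHD of which carries no sub-extremal Kerr final-state decomposition d of its self-determined
exterior O = exteriorOf 𝒟 d.charted with RaysStayInClosure 𝒟 O, HasExhaustiveCharts d (honest radii)
and IsFutureOriented d, there are one asymptotically flat end e of X, an injective one-parameter
admissible family F through D (F 0 = D) tame on e and immersed at 0, and ε > 0 with F c good (as in
TameCurvatureModeExit) for 0 < ‖c‖ < ε. [difficulty: open-problem] -/
@[route_item "route-FinalStateConjecture-NoVacuumStrings"]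
def CensoredDataTameExit : Prop :=
  ∀ (X : Type) [TopologicalSpace X] [ChartedSpace Literature.Geometry.Lorentzian.E3 X] [IsManifold (𝓡 3) ((⊤ : ℕ∞) : WithTop ℕ∞) X] [T2Space X] [SecondCountableTopology X] [ConnectedSpace X], ∀ D ∈ Literature.Geometry.Lorentzian.admissibleVacuumData X, (∃ 𝒟 : Literature.Geometry.Lorentzian.VacuumCauchyDevelopment D, 𝒟.IsMaximal) → (∀ 𝒟 : Literature.Geometry.Lorentzian.VacuumCauchyDevelopment D, 𝒟.IsMaximal → Summit.FinalStateConjecture.HasCompleteNullInfinity 𝒟.toCauchyDevelopment) → (∃ 𝒟 : Literature.Geometry.Lorentzian.VacuumCauchyDevelopment D, 𝒟.IsMaximal ∧ ¬ ∃ (O : Set 𝒟.carrier) (d : Literature.Geometry.Lorentzian.FinalStateDecomposition 𝒟.toSpacetime O 2), (∀ i, Literature.Geometry.Lorentzian.Kerr.IsSubextremal (d.mass i) (d.spin i)) ∧ O = Summit.FinalStateConjecture.exteriorOf 𝒟.toCauchyDevelopment d.charted ∧ Summit.FinalStateConjecture.RaysStayInClosure 𝒟.toCauchyDevelopment O ∧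 Summit.FinalStateConjecture.HasExhaustiveCharts d ∧ Summit.FinalStateConjecture.IsFutureOriented d) → ∃ (e : Literature.Geometry.Lorentzian.AFEnd X) (F : EuclideanSpace ℝ (Fin 1) → Literature.Geometry.Lorentzian.InitialDataSet (𝓡 3) X), Literature.Geometry.Lorentzian.InitialDataSet.IsTameDataFamily e 1 F ∧ Literature.Geometry.Lorentzian.InitialDataSet.IsImmersedAtZero 1 F ∧ F 0 = D ∧ Function.Injective F ∧ (∀ c, F c ∈ Literature.Geometry.Lorentzian.admissibleVacuumData X) ∧ ∃ ε : ℝ, 0 < ε ∧ ∀ c, c ≠ 0 → ‖c‖ < ε → ((∃ 𝒟 : Literature.Geometry.Lorentzian.VacuumCauchyDevelopment (F c), 𝒟.IsMaximal) ∧ ∀ 𝒟 : Literature.Geometry.Lorentzian.VacuumCauchyDevelopment (F c), 𝒟.IsMaximal → Summit.FinalStateConjecture.HasCompleteNullInfinity 𝒟.toCauchyDevelopment ∧ ∃ (O : Set 𝒟.carrier) (d : Literature.Geometry.Lorentzian.FinalStateDecomposition 𝒟.toSpacetime O 2), (∀ i, Literature.Geometry.Lorentzian.Kerr.IsSubextremal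 (d.mass i) (d.spin i)) ∧ O = Summit.FinalStateConjecture.exteriorOf 𝒟.toCauchyDevelopment d.charted ∧ Summit.FinalStateConjecture.RaysStayInClosure 𝒟.toCauchyDevelopment O ∧ Summit.FinalStateConjecture.HasExhaustiveCharts d ∧ Summit.FinalStateConjecture.IsFutureOriented d)

/-- item stmt-FinalStateConjecture-9937 · crux · rank 9 · open · by planner
why it might fail: Known in print (CBG 1969 Thm 3) but unproved here (= fact choquetBruhat_geroch_exists_mghd_cauchy on admissible data, XL), typing-exposed: IsMaximal makes EVERY VacuumCauchyDevelopment.{0} of D embed into one 𝒟; one rogue typed development falsifies it (cf. VacuumDevelopment.isEmpty, 1st render).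
sources: ChoquetBruhatGeroch1969CMP, Sbierski2016AHP, Ringstrom2009, Literature.Geometry.Lorentzian.choquetBruhat_geroch_exists_mghd_cauchy, Literature.Geometry.Lorentzian.choquetBruhat_geroch_exists_mghd_cauchy.forall_mem_admissibleVacuumData, Literature.Geometry.Lorentzian.VacuumDevelopment.isEmpty
[support] every admissible datum has a maximal globally hyperbolic vacuum development, stated over
the repaired structure `VacuumCauchyDevelopment` (the corrected form of the deprecated
`choquetBruhat_geroch_exists_mghd`, recorded in `CauchyProblemExistenceDefect`);
Choquet-Bruhat–Geroch 1969 Thm. 3, Sbierski 2016 Thm. 2.6. Known theorem; large formalisation;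
shared by every route of this summit. [difficulty: XL] -/
@[route_item "route-FinalStateConjecture-NoVacuumStrings"]
def MGHDExistence : Prop :=
  ∀ (X : Type) [TopologicalSpace X] [ChartedSpace Literature.Geometry.Lorentzian.E3 X] [IsManifold (𝓡 3) ((⊤ : ℕ∞) : WithTop ℕ∞) X] [T2Space X] [SecondCountableTopology X] [ConnectedSpace X], ∀ D ∈ Literature.Geometry.Lorentzian.admissibleVacuumData X, ∃ 𝒟 : Literature.Geometry.Lorentzian.VacuumCauchyDevelopment D, 𝒟.IsMaximal

-- item stmt-FinalStateConjecture-14026 · support · rank 9 · open · by planner — informal only, no Lean statement yet: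
--   [support] CLOSED STRINGS ARE TRAPPED, HENCE INVISIBLE (card K3; foreseen layer-2 child of
--   LonelyNakedTips in the glued split ClosedStringsTrapped -> SubcriticalStringsDisperse ->
--   LonelyNakedTips; informal until the definitions U1Reduction / TransverseEnergy land). Let (Z, P0) be
--   a non-flat C^2 singularity model at a first naked point P of an MGHD of admissible data, centred at
--   a minimal TIP, and let K be a Killing field of Z whose local flow moves P0 and which is spacelike
--   without zeros on a neighbourhood of closure(P0) (a translation of the tip). If the transverse energy
--   of the Geroch-Moncrie

-- item stmt-FinalStateConjecture-14082 · support · rank 9 · open · by planner — informal only, no Lean statement yet: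
--   [support] SUB-CRITICAL STRINGS DISPERSE (card K1, Moncrief's asymptotically flat U(1) problem at
--   sub-critical energy; foreseen layer-2 child of LonelyNakedTips; informal until U1Reduction /
--   TransverseEnergy land). For the 2+1 Einstein-wave-map system with target H^2 = SL(2,R)/SO(2) (metric
--   d gamma^2 + (1/4) e^{-4 gamma} d omega^2, curvature -4) obtained by Geroch-Moncrief reduction of 3+1
--   vacuum along a nowhere-vanishing spacelike Killing field, with asymptotically conical quotient of
--   deficit < 2 pi and finite transverse energy E < E*: (i) global regularity with bounds depending only
--   on E (no

-- earlier Assembly (stmt-FinalStateConjecture-12917, replaced 2026-08-16T20:50:03Z -> stmt-FinalStateConjecture-16802): retired by None — MGHDExistence → LocalExitSuffices → NakedModelExists → LonelyNakedTips → LonelyTipExit → CensoredDataExit → FinalStateConjecture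
-- earlier Assembly (stmt-FinalStateConjecture-16802, replaced 2026-08-16T21:07:04Z -> stmt-FinalStateConjecture-16814): retired by None — MGHDExistence → NakedModelExists → LonelyNakedTips → LonelyTipExit → CensoredDataExit → FinalStateConjecture
-- earlier Assembly (stmt-FinalStateConjecture-16814, replaced 2026-08-16T23:16:56Z -> stmt-FinalStateConjecture-17357): retired by None — LonelyNakedTips → NakedModelExists → LonelyTipExit → CensoredDataExit → MGHDExistence → FinalStateConjecture
-- earlier Assembly (stmt-FinalStateConjecture-17357, replaced 2026-08-16T23:47:49Z -> stmt-FinalStateConjecture-18007): retired by None — LonelyNakedTips → NakedModelExists → LonelyTipTameExit → CensoredDataTameExit → MGHDExistence → FinalStateConjecture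
/-- item stmt-FinalStateConjecture-18007 · assembly · rank 1 · open · by planner
sources: Christodoulou1999, DafermosLuk2017
[assembly] LonelyNakedTips → NakedModelExists → LonelyTipTameExit → CensoredDataTameExit →
MGHDExistence → FinalStateConjecture — the five CRUX items in rank order (2, 3, 4, 5, 9) imply the
re-typed Statement, the conclusion pinned to the sub-problem's Statement decl by its fully qualified
name `_root_.FinalStateConjecture`; since rev 10 this is VERBATIM the type of the deciding theorem
`closes` (binders hS hE hX hB hM in the same order; STEP 1 =
`InitialDataSet.isTameChristodoulouGeneric_of_local`, STEP 2 = censored / naked case split), so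
`closes` itself proves this item. -/
@[route_item "route-FinalStateConjecture-NoVacuumStrings"]
def Assembly : Prop :=
  LonelyNakedTips → NakedModelExists → LonelyTipTameExit → CensoredDataTameExit → MGHDExistence → _root_.FinalStateConjecture

-- records of items no longer active in this route (dropped / restated):
-- earlier LocalExitSuffices (stmt-FinalStateConjecture-9938, dropped 2026-08-16T20:50:03Z): proved by Summit.FinalStateConjecture.FinalStateConjecture.Theorems.LocalExitSuffices_proof @ 442927d8e260 — ∀ (X : Type) [TopologicalSpace X] [ChartedSpace Literature.Geometry.Lorentzian.E3 X] [IsManifold (𝓡 3) ((⊤ : ℕ∞) : WithTop ℕ∞) X] [T2Space X] [SecondCountableTopology X] [ConnectedSpace X] (𝓔 : Set (Li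

/-! D-0027 §2.1 — DECIDING THEOREM (planner-authored via `route open/edit --closes-file`; by planner-rbadge-FinalStateConjecture-NoVacuumSt-0e2f79b6-g2-0 2026-08-16T23:47:49Z):
its hypotheses are this route's items and its conclusion the sub-problem Statement (glue_lint), and it elaborates with this file. -/

/-- The deciding theorem of route NoVacuumStrings (D-0027 §2.1), re-derived 2026-08-16 for the re-typed summit (re-type T2,
p126844: TAME genericity `IsTameChristodoulouGeneric` on one fixed end, honest near-zone radii, chart time orientation,
intrinsic lower bound on the settled region) and re-certified 2026-08-16 (route-repair g2). Its type is now VERBATIM the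
`Assembly` item: the five CRUX hypotheses in rank order (2, 3, 4, 5, 9) and the conclusion pinned to the sub-problem's
Statement decl by its fully qualified name `_root_.FinalStateConjecture` (the bare identifier resolves to the same constant
today; the pin keeps it so whatever is later declared in the enclosing `Summit.FinalStateConjecture…` namespaces). The
fullbuild stamp `529:2 Type mismatch` of 23:33Z was raised against the pre-re-type render of this file (rev 7, binders
`LonelyTipExit` / `CensoredDataExit`, broken by the Statement re-type at 21:18Z), not against the rev-8/9 text, which
elaborates natively. Pure logic. Fix `X`. STEP 1 (local-to-global): by the sorry-free Literature lemma
`InitialDataSet.isTameChristodoulouGeneric_of_local` (TameGenericityLocal.lean: the radial contraction of the parameter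
line into the `ε`-ball preserves tameness on the end, immersion at `0`, injectivity, admissibility and the base datum) it
suffices to produce, through every exceptional admissible datum `D`, ONE asymptotically flat end `e` and a tame (on `e`),
immersed, injective family `F` of admissible data with `F 0 = D` whose members with `0 < ‖c‖ < ε` are good in the
summit's sense. STEP 2 (the censored / naked case split): if every maximal development of `D` has complete future null
infinity, `D` is censored — `MGHDExistence` gives an MGHD, exceptionality of `D` yields a maximal development WITHOUT the
summit's settling clause (sub-extremal Kerr decomposition `d` of `O = exteriorOf 𝒟 d.charted` with `RaysStayInClosure`,
`HasExhaustiveCharts`, `IsFutureOriented`), and `CensoredDataTameExit` supplies the tame local exit. Otherwise some MGHD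
`𝒟` has incomplete `𝓘⁺`: `NakedModelExists` gives a first naked point `P` of `𝒟` with a non-flat `C²` singularity model
centred at a minimal TIP; `LonelyNakedTips` (specialised to `D`) says every such model at every first naked point of every
MGHD of `D` has an isometry-fixed tip (rank 0); `LonelyTipTameExit` turns (model, rank 0) into the tame local exit. The
five hypotheses are exactly the route's five CRUX items; no named Literature fact occurs in the cone; axioms propext /
Classical.choice / Quot.sound. -/
@[closes "route-FinalStateConjecture-NoVacuumStrings"] theorem closes (hS : LonelyNakedTips) (hE : NakedModelExists) (hX : LonelyTipTameExit) (hB : CensoredDataTameExit)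
    (hM : MGHDExistence) : _root_.FinalStateConjecture := by
  intro X _ _ _ _ _ _
  -- STEP 1: a local TAME exit through every exceptional datum suffices.
  refine Literature.Geometry.Lorentzian.InitialDataSet.isTameChristodoulouGeneric_of_local
    fun D hAdm hbad ↦ ?_
  -- STEP 2: the censored / naked case split.
  by_cases hC : ∀ 𝒟 : Literature.Geometry.Lorentzian.VacuumCauchyDevelopment D, 𝒟.IsMaximal →
      Summit.FinalStateConjecture.HasCompleteNullInfinity 𝒟.toCauchyDevelopment
  · -- crux #9 `MGHDExistence`: an MGHD of `D` exists (anti-vacuity conjunct of the Statement).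
    obtain ⟨𝒟₀, h𝒟₀⟩ := hM X D hAdm
    -- exceptionality of the censored datum `D`: some MGHD carries no settling decomposition.
    have hns : ∃ 𝒟 : Literature.Geometry.Lorentzian.VacuumCauchyDevelopment D, 𝒟.IsMaximal ∧
        ¬ ∃ (O : Set 𝒟.carrier) (d : Literature.Geometry.Lorentzian.FinalStateDecomposition 𝒟.toSpacetime O 2),
          (∀ i, Literature.Geometry.Lorentzian.Kerr.IsSubextremal (d.mass i) (d.spin i)) ∧
            O = Summit.FinalStateConjecture.exteriorOf 𝒟.toCauchyDevelopment d.charted ∧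
              Summit.FinalStateConjecture.RaysStayInClosure 𝒟.toCauchyDevelopment O ∧
                Summit.FinalStateConjecture.HasExhaustiveCharts d ∧
                  Summit.FinalStateConjecture.IsFutureOriented d := by
      by_contra hcon
      refine hbad ⟨⟨𝒟₀, h𝒟₀⟩, fun 𝒟 h𝒟 ↦ ⟨hC 𝒟 h𝒟, ?_⟩⟩
      by_contra hset
      exact hcon ⟨𝒟, h𝒟, hset⟩
    -- crux #5 `CensoredDataTameExit`.
    exact hB X D hAdm ⟨𝒟₀, h𝒟₀⟩ hC hns
  · -- the naked case: some MGHD `𝒟` of `D` has incomplete future null infinity.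
    obtain ⟨𝒟, h𝒟⟩ := not_forall.mp hC
    obtain ⟨h𝒟max, hinc⟩ := Classical.not_imp.mp h𝒟
    -- crux #3 `NakedModelExists`: a first naked point with a non-flat minimal-TIP-centred C² model.
    obtain ⟨P, hP, 𝓩, P₀, hT, hmin, hnf⟩ := hE X D hAdm 𝒟 h𝒟max hinc
    -- crux #4 `LonelyTipTameExit`, fed with crux #2 `LonelyNakedTips` specialised to `D`.
    exact hX X D hAdm 𝒟 h𝒟max P hP ⟨𝓩, P₀, hT, hmin, hnf⟩ (hS X D hAdm)

end Summit.FinalStateConjecture.FinalStateConjecture.Theses.NoVacuumStrings
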